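import Mathlib
import Summits.ResolutionOfSingularities.ResolutionOfSingularities.Theorems.RadicialJungCleanModelsLens5ArcPotential
import Summits.ResolutionOfSingularities.ResolutionOfSingularities.Theorems.RadicialJungCleanModelsLens5AbsDerivation
import HarnessLib

/-!
# THEOREM P in every dimension (lens 5, g20) — part 1/3: the transport lemma (regular system of parameters completing an independent pair)

PORT (line lead `res-B-lead-1` g10, `--supports stmt-ResolutionOfSingularities-15917 --as helper`) of res-B-lens-5 g20's PORT-READY, sorry-free crux workfile
`Cruxes/DescentPerfectToAll/Lens5_ArcAllDim.lean` REV 2 (tree sha16 b1cb415ca1788138; crit TRIAGE-157/157b PASS; registrar BOOKED #12a), split into three modules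
under `Theorems/` with the declarations VERBATIM (namespace `…Theorems.RadicialJungCleanModels.Lens5ArcAllDim` instead of `…Cruxes.DescentPerfectToAll.Lens5ArcAllDim`)
and the three census `def`s (`CleanLUArcAtDim`, `RSOPCompletionAtDim`, `CleanLUArcAllDim`) replaced by DEF-FREE theorems whose statements are the def bodies
(kernel lane).  CONTENT (lens-5 g20): **THEOREM P in EVERY dimension** — clean local uniformization of the `K^p`-line of `g₀` at a ZERO-DIMENSIONAL DISCRETE
RANK-ONE valuation with NO best `p`-th-power approximation (class (A), «arcs»), at a regular finitely generated centre of ANY Krull dimension `d`, over EVERY ground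
field (LEMMA D-abs ✓ `Lens5.AbsDerivation.absDerivation_of_forall_pow_ne'` + the potential argument ✓ `Lens5.ArcPotentialProof` lineage with the dimension removed
+ the transport lemma `rsop_completion`).  For `d = 3` this is the landed ✓ `cleanLU3DefectArc_of_discrete`; for `d ≥ 4` it is the first kernel theorem of the
lineage in the regime of the PRICE `stub_cleanModelsDimGEFour` (class (A) only; strategically inert for rung B on its own, census-4 addenda B/C).
OURS · counted 0 · nothing here proves resolution in characteristic `p`; `CleanModels` and rung B are NOT proved.

This module: §RSP of the source (`span_range_update_sum_eq`, `exists_isUnit_of_sum_not_mem_sq`, `exists_rsop_extending_pair`, `exists_reindex_pair`,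
`rsop_completion`) and the def-free form `rsopCompletionAtDim` of the census statement `RSOPCompletionAtDim d` (res-B-lens-1 g3, `Census_lens1_g3_DimTransport.lean`).
-/

noncomputable section

set_option linter.dupNamespace false -- mandated namespace of this single-conjunct summit

open IsLocalRing
open Literature.AlgebraicGeometry.Resolution
open Summit.ResolutionOfSingularities.ResolutionOfSingularities.Theorems.RadicialJung.CleanModels
open Summit.ResolutionOfSingularities.ResolutionOfSingularities.Theorems.RadicialJung.CleanModels.Lens5.ArcPotentialProof

namespace Summit.ResolutionOfSingularities.ResolutionOfSingularities.Theorems.RadicialJungCleanModels.Lens5ArcAllDim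

/-! ## The transport lemma: r.s.p. completion of an independent pair in dimension `d` -/

section RSP

variable {S : Type*}

/-- **Exchange lemma.**  If `y = ∑ aⱼ xⱼ` with `aᵢ` a unit, replacing `xᵢ` by `y` does not change the ideal generated. [folklore] -/
theorem span_range_update_sum_eq [CommRing S] {ι : Type*} [Fintype ι] [DecidableEq ι] (x : ι → S) (a : ι → S) (i : ι)
    (hi : IsUnit (a i)) :
    Ideal.span (Set.range (Function.update x i (∑ j, a j * x j))) = Ideal.span (Set.range x) := by
  set y : S := ∑ j, a j * x j with hydef
  apply le_antisymm
  · rw [Ideal.span_le]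
    rintro _ ⟨l, rfl⟩
    rw [SetLike.mem_coe]
    by_cases hl : l = i
    · subst hl
      rw [Function.update_self]
      exact Ideal.sum_mem _ fun j _ => Ideal.mul_mem_left _ _ (Ideal.subset_span ⟨j, rfl⟩)
    · rw [Function.update_of_ne hl]
      exact Ideal.subset_span ⟨l, rfl⟩
  · rw [Ideal.span_le]
    rintro _ ⟨l, rfl⟩
    rw [SetLike.mem_coe]
    by_cases hl : l = i
    · subst hl
      have h1 : Function.update x l y l ∈ Ideal.span (Set.range (Function.update x l y)) :=
        Ideal.subset_span ⟨l, rfl⟩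
      rw [Function.update_self] at h1
      have h2 : ∑ j ∈ Finset.univ.erase l, a j * x j ∈ Ideal.span (Set.range (Function.update x l y)) := by
        refine Ideal.sum_mem _ fun j hj => Ideal.mul_mem_left _ _ ?_
        have hjl : j ≠ l := Finset.ne_of_mem_erase hj
        have h3 : Function.update x l y j ∈ Ideal.span (Set.range (Function.update x l y)) :=
          Ideal.subset_span ⟨j, rfl⟩
        rwa [Function.update_of_ne hjl] at h3
      have hsplit : a l * x l = y - ∑ j ∈ Finset.univ.erase l, a j * x j := by
        rw [hydef, ← Finset.add_sum_erase Finset.univ (fun j => a j * x j) (Finset.mem_univ l)]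
        ring
      have h4 : a l * x l ∈ Ideal.span (Set.range (Function.update x l y)) := by
        rw [hsplit]; exact Ideal.sub_mem _ h1 h2
      obtain ⟨u, hu⟩ := hi
      have h5 : x l = ↑u⁻¹ * (a l * x l) := by
        rw [← mul_assoc, ← hu, Units.inv_mul, one_mul]
      rw [h5]
      exact Ideal.mul_mem_left _ _ h4
    · have h3 : Function.update x i y l ∈ Ideal.span (Set.range (Function.update x i y)) :=
        Ideal.subset_span ⟨l, rfl⟩
      rwa [Function.update_of_ne hl] at h3

/-- If `∑ aⱼ xⱼ ∉ 𝔪²` with all `xⱼ ∈ 𝔪`, some coefficient `aᵢ` is a unit. [folklore] -/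
theorem exists_isUnit_of_sum_not_mem_sq [CommRing S] [IsLocalRing S] {ι : Type*} [Fintype ι] (x : ι → S) (hx : ∀ j, x j ∈ maximalIdeal S)
    (a : ι → S) (h2 : ∑ j, a j * x j ∉ maximalIdeal S ^ 2) : ∃ i, IsUnit (a i) := by
  by_contra hne
  push Not at hne
  apply h2
  rw [pow_two]
  exact Ideal.sum_mem _ fun j _ =>
    Ideal.mul_mem_mul ((mem_maximalIdeal _).mpr (mem_nonunits_iff.mpr (hne j))) (hx j)

/-- **r.s.p. completion of an independent pair** (unordered form): in a regular local ring of dimension `d`, a pair `(π, F)` with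
`π ∈ 𝔪 ∖ 𝔪²`, `F ∈ 𝔪`, independent modulo `𝔪²`, is part of a regular system of parameters `t : Fin d → S`. [folklore] -/
theorem exists_rsop_extending_pair [CommRing S] [IsRegularLocalRing S] {d : ℕ} (hdim : ringKrullDim S = (d : WithBot ℕ∞))
    (π F : S) (hπ : π ∈ maximalIdeal S) (hπ2 : π ∉ maximalIdeal S ^ 2) (hF : F ∈ maximalIdeal S)
    (hind : ∀ a b : S, a * π + b * F ∈ maximalIdeal S ^ 2 → b ∈ maximalIdeal S) :
    ∃ (t : Fin d → S) (i j : Fin d), i ≠ j ∧ t i = π ∧ t j = F ∧ Ideal.span (Set.range t) = maximalIdeal S := by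
  classical
  have hsf : (maximalIdeal S).spanFinrank = d := by
    have e := IsRegularLocalRing.spanFinrank_maximalIdeal (R := S)
    rw [hdim] at e; exact_mod_cast e
  subst hsf
  obtain ⟨x, hx⟩ := Literature.AlgebraicGeometry.Resolution.exists_regularSystemOfParameters (R := S)
  have hxm : ∀ j, x j ∈ maximalIdeal S := fun j => by rw [← hx]; exact Ideal.subset_span ⟨j, rfl⟩
  -- first exchange: `xᵢ ↦ π`
  have hπ' : π ∈ Ideal.span (Set.range x) := by rw [hx]; exact hπ
  obtain ⟨a, ha⟩ := Ideal.mem_span_range_iff_exists_fun.mp hπ'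
  obtain ⟨i, hi⟩ := exists_isUnit_of_sum_not_mem_sq x hxm a (by rw [ha]; exact hπ2)
  have hx₁ : Ideal.span (Set.range (Function.update x i π)) = maximalIdeal S := by
    have e := span_range_update_sum_eq x a i hi
    rw [ha] at e
    exact e.trans hx
  set x₁ := Function.update x i π with hx₁def
  have hx₁i : x₁ i = π := Function.update_self _ _ _
  have hx₁m : ∀ j, x₁ j ∈ maximalIdeal S := fun j => by rw [← hx₁]; exact Ideal.subset_span ⟨j, rfl⟩
  -- second exchange: `xⱼ ↦ F` for some `j ≠ i`
  have hF' : F ∈ Ideal.span (Set.range x₁) := by rw [hx₁]; exact hF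
  obtain ⟨b, hb⟩ := Ideal.mem_span_range_iff_exists_fun.mp hF'
  have hj : ∃ j, j ≠ i ∧ IsUnit (b j) := by
    by_contra hne
    push Not at hne
    have hsq : (-b i) * π + 1 * F ∈ maximalIdeal S ^ 2 := by
      have e : (-b i) * π + 1 * F = ∑ j ∈ Finset.univ.erase i, b j * x₁ j := by
        rw [← hb, ← Finset.add_sum_erase Finset.univ (fun j => b j * x₁ j) (Finset.mem_univ i), hx₁i]
        ring
      rw [e, pow_two]
      refine Ideal.sum_mem _ fun j hj => ?_
      exact Ideal.mul_mem_mul ((mem_maximalIdeal _).mpr (mem_nonunits_iff.mpr (hne j (Finset.ne_of_mem_erase hj)))) (hx₁m j)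
    exact (maximalIdeal.isMaximal S).ne_top ((Ideal.eq_top_iff_one _).mpr (hind _ _ hsq))
  obtain ⟨j, hji, hj⟩ := hj
  have hx₂ : Ideal.span (Set.range (Function.update x₁ j F)) = maximalIdeal S := by
    have e := span_range_update_sum_eq x₁ b j hj
    rw [hb] at e
    exact e.trans hx₁
  refine ⟨Function.update x₁ j F, i, j, hji.symm, ?_, Function.update_self _ _ _, hx₂⟩
  rw [Function.update_of_ne hji.symm, hx₁i]

/-- Reindexing a family `Fin d → S` so that two given distinct indices come first. [folklore] -/
theorem exists_reindex_pair {d : ℕ} (t : Fin d → S) {i j : Fin d} (hij : i ≠ j) :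
    2 ≤ d ∧ ∃ t' : Fin d → S, (∀ l : Fin d, (l : ℕ) = 0 → t' l = t i) ∧ (∀ l : Fin d, (l : ℕ) = 1 → t' l = t j) ∧
      Set.range t' = Set.range t := by
  have hi2 := i.isLt
  have hj2 := j.isLt
  have hne : (i : ℕ) ≠ j := fun h => hij (Fin.ext h)
  have h2 : 2 ≤ d := by omega
  refine ⟨h2, ?_⟩
  obtain ⟨z0, hz0⟩ : ∃ z : Fin d, (z : ℕ) = 0 := ⟨⟨0, by omega⟩, rfl⟩
  obtain ⟨z1, hz1⟩ : ∃ z : Fin d, (z : ℕ) = 1 := ⟨⟨1, by omega⟩, rfl⟩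
  have h01 : z0 ≠ z1 := fun h => by have := congrArg Fin.val h; omega
  let s : Equiv.Perm (Fin d) := Equiv.swap z0 i
  have hs0 : s z0 = i := Equiv.swap_apply_left _ _
  have hssj : s (s j) = j := Equiv.swap_apply_self _ _ _
  have hsj0 : z0 ≠ s j := by
    intro h
    have e : s z0 = s (s j) := by rw [← h]
    rw [hssj, hs0] at e
    exact hij e
  let σ : Equiv.Perm (Fin d) := (Equiv.swap z1 (s j)).trans s
  refine ⟨t ∘ σ, ?_, ?_, ?_⟩
  · intro l hl
    have hl0 : l = z0 := Fin.ext (by omega)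
    rw [hl0]
    change t (s (Equiv.swap z1 (s j) z0)) = t i
    rw [Equiv.swap_apply_of_ne_of_ne h01 hsj0, hs0]
  · intro l hl
    have hl1 : l = z1 := Fin.ext (by omega)
    rw [hl1]
    change t (s (Equiv.swap z1 (s j) z1)) = t j
    rw [Equiv.swap_apply_left, hssj]
  · exact σ.surjective.range_comp t

/-- **r.s.p. completion of an independent pair**, ordered form: `t 0 = π`, `t 1 = F`, and `2 ≤ d` follows. [folklore] -/
theorem rsop_completion [CommRing S] [IsRegularLocalRing S] {d : ℕ} (hdim : ringKrullDim S = (d : WithBot ℕ∞))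
    (π F : S) (hπ : π ∈ maximalIdeal S) (hπ2 : π ∉ maximalIdeal S ^ 2) (hF : F ∈ maximalIdeal S)
    (hind : ∀ a b : S, a * π + b * F ∈ maximalIdeal S ^ 2 → b ∈ maximalIdeal S) :
    2 ≤ d ∧ ∃ t : Fin d → S, (∀ l : Fin d, (l : ℕ) = 0 → t l = π) ∧ (∀ l : Fin d, (l : ℕ) = 1 → t l = F) ∧
      Ideal.span (Set.range t) = maximalIdeal S := by
  obtain ⟨t, i, j, hij, hti, htj, ht⟩ := exists_rsop_extending_pair hdim π F hπ hπ2 hF hind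
  obtain ⟨h2, t', h0, h1, hr⟩ := exists_reindex_pair t hij
  refine ⟨h2, t', fun l hl => (h0 l hl).trans hti, fun l hl => (h1 l hl).trans htj, ?_⟩
  rw [← ht, hr]


end RSP

/-- **The transport lemma `RSOPCompletionAtDim d` (census statement of res-B-lens-1 g3, body VERBATIM, def-free)**: in a regular local ring of Krull dimension `d`
a pair `(π, F)` with `π ∈ 𝔪 ∖ 𝔪²`, `F ∈ 𝔪`, independent modulo `𝔪²`, extends to a regular system of parameters `t` with `t 0 = π`, `t 1 = F`. [folklore] -/
theorem rsopCompletionAtDim (d : ℕ) :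
    ∀ (S : Type) [CommRing S] [IsLocalRing S] [IsNoetherianRing S], IsRegularLocalRing S →
    ringKrullDim S = (d : WithBot ℕ∞) → 2 ≤ d →
    ∀ π F : S, π ∈ maximalIdeal S → π ∉ maximalIdeal S ^ 2 → F ∈ maximalIdeal S →
    (∀ a b : S, a * π + b * F ∈ maximalIdeal S ^ 2 → b ∈ maximalIdeal S) →
    ∃ t : Fin d → S, (∀ h0 : 0 < d, t ⟨0, h0⟩ = π) ∧ (∀ h1 : 1 < d, t ⟨1, h1⟩ = F) ∧
      Ideal.span (Set.range t) = maximalIdeal S := by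
  intro S _ _ _ hreg hdim _ π F hπ hπ2 hF hind
  obtain ⟨-, t, h0, h1, ht⟩ := rsop_completion hdim π F hπ hπ2 hF hind
  exact ⟨t, fun _ => h0 _ rfl, fun _ => h1 _ rfl, ht⟩

end Summit.ResolutionOfSingularities.ResolutionOfSingularities.Theorems.RadicialJungCleanModels.Lens5ArcAllDim

end
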